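import Summits.AtomisticToContinuum.Crystallization.Theorems.FrustratedLawDichotomyCoherentFloor

/-!
# FrustratedLawDichotomy · crux `AperiodicFrustratedLawGap` (stmt-AtomisticToContinuum-27623) — CELL-SOUND I: THE LABEL FRAME
(cell decomp-a2c, lens-5 g113; class-A row recipe of the coherence atlas; feeds the `hfloor` clause of (228)
`…FrustratedLawDichotomyAtlasDoor.aperiodicFrustratedLawGap_of_atlas`)

Role.  (226) `certFloor T I y τ Rc` is stated over an `E3`-template `T : Finset E3` and `E3`-indexed multipliers; a class-A CELL is a BOX of
placements of one LABEL template (sites `m : ι`, positions `pos m`, multipliers `Y m` on a label set `MI`).  This file moves the certificate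
floor to the label frame once and for all, so that cell K-files (interval arithmetic over a strain / metric box) never touch `Finset E3`
images, `mulExt`, or injectivity:
1. `certFloorL M MI o pos Y τ Rc` — the certificate floor written over labels (`certCoeffL`, `YE`, `dispL`), and `certFloor_image_eq`:
   for positions injective on `M` (automatic from `δ`-separation, `injOn_of_sep`) it EQUALS (226)'s `certFloor` of the placed template.
2. ★ `certFloorL_le_two_mul_rootEnergy_of_nash` — (226) T2 in the label frame.
3. ★ `lb_le_certFloorL` — the COLUMN MASTER inequality: `certFloorL` unfolded once into host column `H`, debits `D`, NASH column `N`,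
   host-force pairings `HF`, far force `FC`, force remainder `RM`, energy tail `tc`: `H − D − τN − HF − FC − RM − tc ≤ certFloorL`.
4. ★ `rowFloor_of_cells` — ROW PACKAGING for the atlas door: a cell is a family of placements `posF F`, `YF F` over a parameter set `B`
   (strain or metric box); admissible + certified (`2(cUp + mc) ≤ certFloorL`, `c ≤ cUp`, e.g. `cUp = −7175/10000` by
   `…PeriodicEnergyCeilingKernel.eStar_le`) ⇒ on the row `⋃_{F∈B} coherentAt (M.image (posF F)) τ Rc` every rooted `7/10`-hard-core NASH
   configuration has `c + mc ≤ rootEnergy` — literally the `hfloor` clause of (228) for that row.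
The truncations of the columns (near lists + closed-form tails) are in `…CellTails` / `…CellTailsRem`; the metric (Gram) frame for
orientation-free cells in `…CellMetric`.  Dials of record (crit r1764 R1): `τ_A = 1/1024`, `R_A = 4`, `Rc = 15` (F1) / `14` (fcc twin).

House conventions: SI units · italic scalars (*r*, *τ*, *φ*), bold vectors, sans-serif tensors · numbered formulae only when referenced ·
en-dash for ranges · References = cited works, numbered, alphabetical · no footnotes; Remarks at section ends · British spelling, -ise ·
Lennard-Jones hyphenated; Nash capitalised only as NASH (the equilibrium notion of the Statement) · "folklore" tags statements whose
content is standard bookkeeping (no single source); no new references are cited in this file.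
-/

noncomputable section

namespace Summit.AtomisticToContinuum.Crystallization.Theorems.FrustratedLawDichotomyCellFrame

open MeasureTheory Metric Set RealInnerProductSpace
open scoped BigOperators
open Literature.MathematicalPhysics.StatisticalMechanics (lennardJones rootEnergy)
open Literature.Probability.Process (IsRootedHardCore)
open Summit.AtomisticToContinuum.Crystallization.Theorems.ChargedEnergyGapNegative (E3)
open Summit.AtomisticToContinuum.Crystallization.Theorems.FrustratedLawDichotomyCoherentSets (coherentAt)
open Summit.AtomisticToContinuum.Crystallization.Theorems.FrustratedLawDichotomyCoherentFloorAlgebra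
open Summit.AtomisticToContinuum.Crystallization.Theorems.FrustratedLawDichotomyCoherentFloor

variable {ι : Type*} [DecidableEq ι]


/-! ## §1. Cell data in the LABEL frame and the label-frame certificate floor -/

/-- The multiplier field on `E3` induced by label multipliers `Y` on the interior labels `MI` placed at `pos`:
`mulOf MI pos Y (pos m) = Y m` for `m ∈ MI` (positions injective), `0` off the interior template. -/
def mulOf (MI : Finset ι) (pos Y : ι → E3) (x : E3) : E3 := ∑ m ∈ MI, if pos m = x then Y m else 0

/-- Label-frame multipliers extended by `0` off the interior (`= mulExt I y ∘ pos`). -/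
def YE (MI : Finset ι) (Y : ι → E3) (m : ι) : E3 := if m ∈ MI then Y m else 0

/-- Label-frame displacement allowance (`= dispB τ ∘ pos`): the root label `o` is pinned. -/
def dispL (o : ι) (τ : ℝ) (m : ι) : ℝ := if m = o then 0 else τ

/-- Label-frame adjoint coefficient (`= certCoeff a I y ∘ pos`). -/
def certCoeffL (M MI : Finset ι) (pos Y : ι → E3) (m : ι) : E3 :=
  (if m ∈ MI then ∑ m' ∈ M.erase m, ljBondForceLin (pos m - pos m') (Y m) else 0)
    - ∑ x ∈ MI.erase m, ljBondForceLin (pos x - pos m) (Y x)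

/-- ★ THE LABEL-FRAME CERTIFICATE FLOOR: `certFloor` of (226) written over the label sets `M ∋ o` (template), `MI ⊆ M` (interior),
positions `pos : ι → E3` (`pos o = 0`) and label multipliers `Y`.  Equal to `certFloor (M.image pos) (MI.image pos) (mulOf MI pos Y) τ Rc`
(`certFloor_image_eq`). -/
def certFloorL (M MI : Finset ι) (o : ι) (pos Y : ι → E3) (τ Rc : ℝ) : ℝ :=
  ∑ m ∈ M.erase o, (phiT (‖pos m‖ ^ 2) - (τ ^ 2 * secondNeg ‖pos m‖ + energyRem ‖pos m‖ τ))
    - τ * ∑ m ∈ M.erase o, ‖psiT (‖pos m‖ ^ 2) • pos m - certCoeffL M MI pos Y m‖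
    - ∑ m ∈ MI, ⟪Y m, ∑ m' ∈ M.erase m, ljBondForce (pos m - pos m')⟫
    - ∑ m ∈ MI, ‖Y m‖ * farCol (Rc - (‖pos m‖ + τ))
    - 1 / 2 * ∑ m ∈ M, ∑ m' ∈ M.erase m, ‖YE MI Y m - YE MI Y m'‖ * forceRem ‖pos m - pos m'‖ (dispL o τ m + dispL o τ m')
    - tailCol Rc

/-! ## §2. The frame change `E3`-template ↔ labels (positions injective on `M`) -/

section Frame

variable {M MI : Finset ι} {o : ι} {pos Y : ι → E3}

/-- Erasing a template point = erasing its label (positions injective on `M ⊇ S`). [folklore] -/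
theorem image_erase_eq (hinj : Set.InjOn pos ↑M) {S : Finset ι} (hS : S ⊆ M) {m : ι} (hm : m ∈ M) :
    (S.image pos).erase (pos m) = (S.erase m).image pos := by
  classical
  ext x
  simp only [Finset.mem_erase, Finset.mem_image]
  constructor
  · rintro ⟨hx, m', hm', rfl⟩
    exact ⟨m', ⟨fun h => hx (by rw [h]), hm'⟩, rfl⟩
  · rintro ⟨m', ⟨hm'm, hm'⟩, rfl⟩
    exact ⟨fun h => hm'm (hinj (hS hm') hm h), m', hm', rfl⟩

omit [DecidableEq ι] in
/-- Injectivity on a sub-label-set in the form `Finset.sum_image` wants. [folklore] -/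
theorem injOn_sub (hinj : Set.InjOn pos ↑M) {S : Finset ι} (hS : S ⊆ M) :
    ∀ a ∈ S, ∀ b ∈ S, pos a = pos b → a = b := fun _ ha _ hb hab => hinj (hS ha) (hS hb) hab

omit [DecidableEq ι] in
/-- A template point is an interior point iff its label is interior. [folklore] -/
theorem pos_mem_image_iff (hinj : Set.InjOn pos ↑M) (hMI : MI ⊆ M) {m : ι} (hm : m ∈ M) :
    pos m ∈ MI.image pos ↔ m ∈ MI := by
  classical
  rw [Finset.mem_image]
  constructor
  · rintro ⟨m', hm', h⟩
    rwa [← hinj (hMI hm') hm h]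
  · exact fun h => ⟨m, h, rfl⟩

omit [DecidableEq ι] in
/-- `mulOf` recovers the label multiplier at an interior template point. [folklore] -/
theorem mulOf_pos (hinj : Set.InjOn pos ↑M) (hMI : MI ⊆ M) {m : ι} (hm : m ∈ MI) :
    mulOf MI pos Y (pos m) = Y m := by
  unfold mulOf
  rw [Finset.sum_eq_single_of_mem m hm]
  · rw [if_pos rfl]
  · intro m' hm' hne
    rw [if_neg]
    exact fun h => hne (hinj (hMI hm') (hMI hm) h)

/-- `mulExt I y ∘ pos = YE`. [folklore] -/
theorem mulExt_pos (hinj : Set.InjOn pos ↑M) (hMI : MI ⊆ M) {m : ι} (hm : m ∈ M) :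
    mulExt (MI.image pos) (mulOf MI pos Y) (pos m) = YE MI Y m := by
  unfold mulExt YE
  by_cases h : m ∈ MI
  · rw [if_pos ((pos_mem_image_iff hinj hMI hm).2 h), if_pos h, mulOf_pos hinj hMI h]
  · rw [if_neg (fun h' => h ((pos_mem_image_iff hinj hMI hm).1 h')), if_neg h]

/-- `certCoeff a I y ∘ pos = certCoeffL`. [folklore] -/
theorem certCoeff_pos (hinj : Set.InjOn pos ↑M) (hMI : MI ⊆ M) {m : ι} (hm : m ∈ M) :
    certCoeff (M.image pos) (MI.image pos) (mulOf MI pos Y) (pos m) = certCoeffL M MI pos Y m := by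
  classical
  unfold certCoeff certCoeffL
  congr 1
  · by_cases h : m ∈ MI
    · rw [if_pos ((pos_mem_image_iff hinj hMI hm).2 h), if_pos h, image_erase_eq hinj subset_rfl hm,
        Finset.sum_image (injOn_sub hinj (Finset.erase_subset m M)), mulOf_pos hinj hMI h]
    · rw [if_neg (fun h' => h ((pos_mem_image_iff hinj hMI hm).1 h')), if_neg h]
  · rw [image_erase_eq hinj hMI hm, Finset.sum_image (injOn_sub hinj ((Finset.erase_subset m MI).trans hMI))]
    exact Finset.sum_congr rfl fun x hx => by rw [mulOf_pos hinj hMI (Finset.mem_of_mem_erase hx)]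

/-- `dispB τ ∘ pos = dispL o τ` (root label `o`, `pos o = 0`). [folklore] -/
theorem dispB_pos (hinj : Set.InjOn pos ↑M) (ho : o ∈ M) (h0 : pos o = 0) {m : ι} (hm : m ∈ M) (τ : ℝ) :
    dispB τ (pos m) = dispL o τ m := by
  unfold dispB dispL
  have : pos m = 0 ↔ m = o := ⟨fun h => hinj hm ho (h.trans h0.symm), fun h => h ▸ h0⟩
  by_cases hmo : m = o
  · rw [if_pos (this.2 hmo), if_pos hmo]
  · rw [if_neg (fun h => hmo (this.1 h)), if_neg hmo]

/-- ★ THE FRAME CHANGE: `certFloor` of the `E3`-template `M.image pos` with interior `MI.image pos` and multipliers `mulOf MI pos Y` IS the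
label-frame floor `certFloorL` (positions injective on `M`, `o ∈ M`, `pos o = 0`, `MI ⊆ M`). [folklore] -/
theorem certFloor_image_eq (hinj : Set.InjOn pos ↑M) (ho : o ∈ M) (h0 : pos o = 0) (hMI : MI ⊆ M) (τ Rc : ℝ) :
    certFloor (M.image pos) (MI.image pos) (mulOf MI pos Y) τ Rc = certFloorL M MI o pos Y τ Rc := by
  classical
  have e0 : (M.image pos).erase 0 = (M.erase o).image pos := by
    rw [← h0]; exact image_erase_eq hinj subset_rfl ho
  have hEo := injOn_sub hinj (Finset.erase_subset o M)
  unfold certFloor certFloorL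
  have t1 : ∑ x ∈ (M.image pos).erase 0, (phiT (‖x‖ ^ 2) - (τ ^ 2 * secondNeg ‖x‖ + energyRem ‖x‖ τ))
      = ∑ m ∈ M.erase o, (phiT (‖pos m‖ ^ 2) - (τ ^ 2 * secondNeg ‖pos m‖ + energyRem ‖pos m‖ τ)) := by
    rw [e0, Finset.sum_image hEo]
  have t2 : ∑ z ∈ (M.image pos).erase 0, ‖psiT (‖z‖ ^ 2) • z - certCoeff (M.image pos) (MI.image pos) (mulOf MI pos Y) z‖
      = ∑ m ∈ M.erase o, ‖psiT (‖pos m‖ ^ 2) • pos m - certCoeffL M MI pos Y m‖ := by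
    rw [e0, Finset.sum_image hEo]
    exact Finset.sum_congr rfl fun m hm => by rw [certCoeff_pos hinj hMI (Finset.mem_of_mem_erase hm)]
  have t3 : ∑ x ∈ MI.image pos, ⟪mulOf MI pos Y x, ∑ x' ∈ (M.image pos).erase x, ljBondForce (x - x')⟫
      = ∑ m ∈ MI, ⟪Y m, ∑ m' ∈ M.erase m, ljBondForce (pos m - pos m')⟫ := by
    rw [Finset.sum_image (injOn_sub hinj hMI)]
    exact Finset.sum_congr rfl fun m hm => by
      rw [mulOf_pos hinj hMI hm, image_erase_eq hinj subset_rfl (hMI hm), Finset.sum_image (injOn_sub hinj (Finset.erase_subset m M))]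
  have t4 : ∑ x ∈ MI.image pos, ‖mulOf MI pos Y x‖ * farCol (Rc - (‖x‖ + τ)) = ∑ m ∈ MI, ‖Y m‖ * farCol (Rc - (‖pos m‖ + τ)) := by
    rw [Finset.sum_image (injOn_sub hinj hMI)]
    exact Finset.sum_congr rfl fun m hm => by rw [mulOf_pos hinj hMI hm]
  have t5 : ∑ x ∈ M.image pos, ∑ x' ∈ (M.image pos).erase x,
        ‖mulExt (MI.image pos) (mulOf MI pos Y) x - mulExt (MI.image pos) (mulOf MI pos Y) x'‖ * forceRem ‖x - x'‖ (dispB τ x + dispB τ x')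
      = ∑ m ∈ M, ∑ m' ∈ M.erase m, ‖YE MI Y m - YE MI Y m'‖ * forceRem ‖pos m - pos m'‖ (dispL o τ m + dispL o τ m') := by
    rw [Finset.sum_image (injOn_sub hinj subset_rfl)]
    refine Finset.sum_congr rfl fun m hm => ?_
    rw [image_erase_eq hinj subset_rfl hm, Finset.sum_image (injOn_sub hinj (Finset.erase_subset m M))]
    refine Finset.sum_congr rfl fun m' hm' => ?_
    rw [mulExt_pos hinj hMI hm, mulExt_pos hinj hMI (Finset.mem_of_mem_erase hm'), dispB_pos hinj ho h0 hm,
      dispB_pos hinj ho h0 (Finset.mem_of_mem_erase hm')]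
  rw [t1, t2, t3, t4, t5]

/-- Separation of the placed labels gives injectivity. [folklore] -/
theorem injOn_of_sep {δ : ℝ} (hδ : 0 < δ) (hsep : ∀ m ∈ M, ∀ m' ∈ M, m ≠ m' → δ ≤ dist (pos m) (pos m')) :
    Set.InjOn pos ↑M := by
  intro m hm m' hm' h
  by_contra hne
  have h1 := hsep m hm m' hm' hne
  rw [h, dist_self] at h1
  exact absurd h1 (not_le.mpr hδ)

end Frame

/-! ## §3. ★ T2 in the label frame, the termwise MASTER inequality, and the row packaging for the atlas door -/

/-- ★★ **T2 IN THE LABEL FRAME.**  For a rooted `7/10`-hard-core `μ` satisfying the NASH clause (e) verbatim and coherent (tolerance `τ`, window `Rc`)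
with the placed template `M.image pos` (`o ∈ M` the root label, `pos o = 0`, interior labels `MI ⊆ M`, placed labels `2τ`-separated, inside the window,
interior at least `7/20` inside): `certFloorL M MI o pos Y τ Rc ≤ 2·rootEnergy V_LJ μ` for ANY label multipliers `Y`. [folklore] -/
theorem certFloorL_le_two_mul_rootEnergy_of_nash {μ : Measure E3} {τ Rc : ℝ} (M MI : Finset ι) (o : ι) (pos Y : ι → E3)
    (hμ : IsRootedHardCore (7 / 10) μ)
    (hNash : ∀ p : E3, μ {p} ≠ 0 → ∀ w : E3, (∀ q : E3, μ {q} ≠ 0 → q ≠ p → w ≠ q) →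
      ∑' q : {q : E3 // μ {q} ≠ 0 ∧ q ≠ p}, lennardJones (dist p (q : E3)) ≤
        ∑' q : {q : E3 // μ {q} ≠ 0 ∧ q ≠ p}, lennardJones (dist w (q : E3)))
    (hτ0 : 0 ≤ τ) (hτ : 2 * τ < 7 / 10) (hRc : 1 ≤ Rc) (hcoh : μ ∈ coherentAt (M.image pos) τ Rc)
    (ho : o ∈ M) (h0 : pos o = 0) (hMI : MI ⊆ M)
    (hsep : ∀ m ∈ M, ∀ m' ∈ M, m ≠ m' → 2 * τ < dist (pos m) (pos m'))
    (hin : ∀ m ∈ M, ‖pos m‖ + τ ≤ Rc) (hI : ∀ m ∈ MI, 7 / 20 ≤ Rc - (‖pos m‖ + τ)) :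
    certFloorL M MI o pos Y τ Rc ≤ 2 * rootEnergy lennardJones μ := by
  classical
  have hinj : Set.InjOn pos ↑M := by
    intro m hm m' hm' h
    by_contra hne
    have h1 := hsep m hm m' hm' hne
    rw [h, dist_self] at h1
    linarith
  rw [← certFloor_image_eq hinj ho h0 hMI]
  refine certFloor_le_two_mul_rootEnergy_of_nash _ hμ hNash hτ0 hτ hRc hcoh (Finset.mem_image.2 ⟨o, ho, h0⟩)
    (Finset.image_subset_image hMI) ?_ ?_ ?_
  · intro x hx x' hx' hne
    obtain ⟨m, hm, rfl⟩ := Finset.mem_image.1 hx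
    obtain ⟨m', hm', rfl⟩ := Finset.mem_image.1 hx'
    exact hsep m hm m' hm' fun h => hne (by rw [h])
  · intro x hx
    obtain ⟨m, hm, rfl⟩ := Finset.mem_image.1 hx
    exact hin m hm
  · intro x hx
    obtain ⟨m, hm, rfl⟩ := Finset.mem_image.1 hx
    exact hI m hm

/-- ★ **THE COLUMN MASTER INEQUALITY (label frame).**  `certFloorL` is unfolded ONCE: an aggregate lower bound `H` of the host column and
aggregate upper bounds `D, N, HF, FC, RM, tc` of the six booked columns (debits, NASH, host-force pairings, far force, force remainder, energy
tail) give `H − D − τN − HF − FC − RM − tc ≤ certFloorL`.  The truncated master `lb_le_certFloorL_trunc` below feeds each aggregate. [folklore] -/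
theorem lb_le_certFloorL (M MI : Finset ι) (o : ι) (pos Y : ι → E3) {τ Rc : ℝ} (hτ0 : 0 ≤ τ) {H D N HF FC RM tc : ℝ}
    (hH : H ≤ ∑ m ∈ M.erase o, phiT (‖pos m‖ ^ 2))
    (hD : ∑ m ∈ M.erase o, (τ ^ 2 * secondNeg ‖pos m‖ + energyRem ‖pos m‖ τ) ≤ D)
    (hN : ∑ m ∈ M.erase o, ‖psiT (‖pos m‖ ^ 2) • pos m - certCoeffL M MI pos Y m‖ ≤ N)
    (hHF : ∑ m ∈ MI, ⟪Y m, ∑ m' ∈ M.erase m, ljBondForce (pos m - pos m')⟫ ≤ HF)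
    (hFC : ∑ m ∈ MI, ‖Y m‖ * farCol (Rc - (‖pos m‖ + τ)) ≤ FC)
    (hRM : 1 / 2 * ∑ m ∈ M, ∑ m' ∈ M.erase m, ‖YE MI Y m - YE MI Y m'‖ * forceRem ‖pos m - pos m'‖ (dispL o τ m + dispL o τ m') ≤ RM)
    (htc : tailCol Rc ≤ tc) :
    H - D - τ * N - HF - FC - RM - tc ≤ certFloorL M MI o pos Y τ Rc := by
  unfold certFloorL
  rw [Finset.sum_sub_distrib]
  have h2 := mul_le_mul_of_nonneg_left hN hτ0
  linarith

/-- ★ ROW PACKAGING FOR THE ATLAS DOOR.  A cell is a family of placements `posF F` and label multipliers `YF F` over a parameter set `B`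
(the strain box); if every placement is admissible (root label at `0`, `2τ`-separated, inside the window, interior `7/20` inside) and
CERTIFIED (`2(c + mc) ≤ certFloorL`), then on the row `⋃_{F ∈ B} coherentAt (M.image (posF F)) τ Rc` every rooted `7/10`-hard-core Nash
configuration has `c + mc ≤ rootEnergy` — the `hfloor` clause of (228) `…AtlasDoor.aperiodicFrustratedLawGap_of_atlas` for this row
(take `c = e⋆`; measurability of the row for countable `B`: (189) `…CoherentSets.measurableSet_iUnion_coherentAt`). [folklore] -/
theorem rowFloor_of_cells {κ : Type*} (B : Set κ) (M MI : Finset ι) (o : ι) (posF YF : κ → ι → E3) {τ Rc c mc : ℝ}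
    (hτ0 : 0 ≤ τ) (hτ : 2 * τ < 7 / 10) (hRc : 1 ≤ Rc) (ho : o ∈ M) (hMI : MI ⊆ M)
    (h0 : ∀ F ∈ B, posF F o = 0)
    (hsep : ∀ F ∈ B, ∀ m ∈ M, ∀ m' ∈ M, m ≠ m' → 2 * τ < dist (posF F m) (posF F m'))
    (hin : ∀ F ∈ B, ∀ m ∈ M, ‖posF F m‖ + τ ≤ Rc) (hI : ∀ F ∈ B, ∀ m ∈ MI, 7 / 20 ≤ Rc - (‖posF F m‖ + τ))
{cUp : ℝ} (hc : c ≤ cUp) (hcert : ∀ F ∈ B, 2 * (cUp + mc) ≤ certFloorL M MI o (posF F) (YF F) τ Rc)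
    (μ : Measure E3) (hμ : IsRootedHardCore (7 / 10) μ)
    (hNash : ∀ p : E3, μ {p} ≠ 0 → ∀ w : E3, (∀ q : E3, μ {q} ≠ 0 → q ≠ p → w ≠ q) →
      ∑' q : {q : E3 // μ {q} ≠ 0 ∧ q ≠ p}, lennardJones (dist p (q : E3)) ≤
        ∑' q : {q : E3 // μ {q} ≠ 0 ∧ q ≠ p}, lennardJones (dist w (q : E3)))
    (hrow : μ ∈ ⋃ F ∈ B, coherentAt (M.image (posF F)) τ Rc) :
    c + mc ≤ rootEnergy lennardJones μ := by
  obtain ⟨F, hF, hcoh⟩ := Set.mem_iUnion₂.1 hrow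
  have h := certFloorL_le_two_mul_rootEnergy_of_nash M MI o (posF F) (YF F) hμ hNash hτ0 hτ hRc hcoh ho (h0 F hF) hMI (hsep F hF)
    (hin F hF) (hI F hF)
  linarith [hcert F hF]

end Summit.AtomisticToContinuum.Crystallization.Theorems.FrustratedLawDichotomyCellFrame
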